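import Mathlib.MeasureTheory.Constructions.Polish.StronglyMeasurable
import Mathlib.MeasureTheory.OuterMeasure.BorelCantelli
import Mathlib.Analysis.SpecificLimits.Basic
import Mathlib.Topology.UniformSpace.UniformApproximation
import Literature.Probability.Process.ItoCalculus
import HarnessLib

/-!
# Limits uniformly on compacts in probability (u.c.p.) of continuous adapted processes

The completeness step of the construction of the Itô integral, in the form needed by the raw
(uncompleted) filtrations of `Literature`: a sequence `Y n` of processes indexed by `ℝ≥0` with
*everywhere* continuous paths, strongly adapted to a filtration `𝓕`, which is **Cauchy uniformly
on compacts in probability**, has a u.c.p. limit `J` (`Literature.TendstoUCP Y J P`) which is strongly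
adapted to the *same* filtration, has a.s. continuous paths, and is the a.s. locally uniform limit
of a subsequence (`Literature.Probability.Process.exists_tendstoUCP_of_cauchy`). No modification on null sets is made (that
would destroy adaptedness to a raw filtration): `J t = limUnder (fun k ↦ Y (φ k) t)` pointwise.

Ingredients: a fast subsequence and Borel–Cantelli (`MeasureTheory.measure_limsup_atTop_eq_zero`),
uniform Cauchy ⇒ uniform convergence to the pointwise `limUnder`, measurability of `limUnder`
(`MeasureTheory.StronglyMeasurable.limUnder`), and the passage from "a.e. eventually outside
measurable sets" to "measures tend to `0`" (`Literature.Probability.Process.tendsto_measure_of_ae_eventually_notMem`).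

## References

* D. Revuz, M. Yor, *Continuous Martingales and Brownian Motion* (3rd ed., 1999), Ch. IV, §2,
  proof of Thm (2.12) ("the desired convergence is then easily established by the same argument
  as in Theorem (1.8)"), and Ch. IV, §1, proof of Thm (1.8) (a sequence converging uniformly on
  compacts in probability has an a.s. uniformly convergent subsequence, whose limit is continuous).
* P. Protter, *Stochastic Integration and Differential Equations* (2nd ed., 2004), Ch. II, §4
  (u.c.p. convergence; completeness).
-/

open MeasureTheory Filter Finset
open scoped NNReal ENNReal Topology

namespace Literature.Probability.Process

variable {Ω : Type*} {m : MeasurableSpace Ω} {P : Measure Ω}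

/-! ### From "a.e. eventually outside" to "measure tends to zero" -/

/-- If almost every point is eventually outside the measurable sets `S k`, then `P (S k) → 0`
(finite measure). [folklore] -/
theorem tendsto_measure_of_ae_eventually_notMem [IsFiniteMeasure P] {S : ℕ → Set Ω}
    (hS : ∀ k, MeasurableSet (S k)) (h : ∀ᵐ ω ∂P, ∀ᶠ k in atTop, ω ∉ S k) :
    Tendsto (fun k ↦ P (S k)) atTop (𝓝 0) := by
  -- `T k = ⋃_{j ≥ k} S j` decreases to a null set
  let T : ℕ → Set Ω := fun k ↦ ⋃ j ≥ k, S j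
  have hT : ∀ k, MeasurableSet (T k) := fun k ↦
    MeasurableSet.biUnion (Set.to_countable _) fun j _ ↦ hS j
  have hanti : Antitone T := fun k l hkl ↦
    Set.biUnion_subset_biUnion_left fun j hj ↦ le_trans hkl hj
  have hnull : P (⋂ k, T k) = 0 := by
    rw [measure_eq_zero_iff_ae_notMem]
    filter_upwards [h] with ω hω hmem
    obtain ⟨K, hK⟩ := eventually_atTop.1 hω
    have : ω ∈ T K := Set.mem_iInter.1 hmem K
    obtain ⟨j, hj, hjω⟩ := Set.mem_iUnion₂.1 this
    exact hK j hj hjω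
  have hlim := tendsto_measure_iInter_atTop (μ := P) (fun k ↦ (hT k).nullMeasurableSet) hanti
    ⟨0, measure_ne_top _ _⟩
  rw [hnull] at hlim
  refine tendsto_of_tendsto_of_tendsto_of_le_of_le tendsto_const_nhds hlim (fun k ↦ zero_le)
    fun k ↦ measure_mono ?_
  exact Set.subset_biUnion_of_mem (u := fun j ↦ S j) (show k ≥ k from le_rfl)

/-! ### Deterministic: fast Cauchy sequences of paths converge locally uniformly -/

/-- A sequence of paths whose consecutive differences are eventually `< 2⁻ᵏ` on `[0, k]` is
uniformly Cauchy on every `[0, t]`. [folklore] -/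
theorem uniformCauchySeqOn_of_fast {g : ℕ → ℝ≥0 → ℝ} {K : ℕ}
    (hg : ∀ k ≥ K, ∀ s ≤ ((k : ℕ) : ℝ≥0), |g (k + 1) s - g k s| < (1 / 2 : ℝ) ^ k) (t : ℝ≥0) :
    UniformCauchySeqOn g atTop (Set.Iic t) := by
  obtain ⟨K₁, hK₁⟩ := exists_nat_ge (t : ℝ)
  set K₀ := max K K₁ with hK₀
  -- tail estimate: for `k ≥ K₀` and `s ≤ t`, `|g (k + j) s - g k s| ≤ 2 (1/2)^k`
  have htail : ∀ k ≥ K₀, ∀ j, ∀ s ≤ t, |g (k + j) s - g k s| ≤ 2 * (1 / 2 : ℝ) ^ k := by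
    intro k hk j s hs
    have hsk : ∀ i ≥ k, s ≤ (i : ℝ≥0) := fun i hi ↦ by
      have : (t : ℝ) ≤ i := hK₁.trans (by exact_mod_cast (le_max_right K K₁).trans (hk.trans hi))
      exact hs.trans (by exact_mod_cast this)
    -- sharper invariant: `≤ 2 (1/2)^k (1 - (1/2)^j)`
    suffices |g (k + j) s - g k s| ≤ 2 * (1 / 2 : ℝ) ^ k * (1 - (1 / 2) ^ j) by
      refine this.trans ?_
      have h1 : (1 : ℝ) - (1 / 2) ^ j ≤ 1 := by
        linarith [pow_nonneg (by norm_num : (0 : ℝ) ≤ 1 / 2) j]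
      have h2 : (0 : ℝ) ≤ 2 * (1 / 2) ^ k := by positivity
      nlinarith
    induction j with
    | zero => simp
    | succ j ih =>
      have hstep := hg (k + j) ((le_max_left K K₁).trans (hk.trans (Nat.le_add_right k j)))
        s (hsk (k + j) (Nat.le_add_right k j))
      calc |g (k + (j + 1)) s - g k s|
          = |(g (k + j + 1) s - g (k + j) s) + (g (k + j) s - g k s)| := by ring_nf
        _ ≤ |g (k + j + 1) s - g (k + j) s| + |g (k + j) s - g k s| := abs_add_le _ _
        _ ≤ (1 / 2 : ℝ) ^ (k + j) + 2 * (1 / 2 : ℝ) ^ k * (1 - (1 / 2) ^ j) :=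
            add_le_add hstep.le ih
        _ = 2 * (1 / 2 : ℝ) ^ k * (1 - (1 / 2) ^ (j + 1)) := by rw [pow_add, pow_succ]; ring
  -- conclude
  rw [Metric.uniformCauchySeqOn_iff]
  intro ε hε
  obtain ⟨N, hN⟩ : ∃ N : ℕ, 2 * (1 / 2 : ℝ) ^ N < ε / 2 := by
    obtain ⟨N, hN⟩ := exists_pow_lt_of_lt_one (by positivity : 0 < ε / 4)
      (by norm_num : (1 / 2 : ℝ) < 1)
    exact ⟨N, by linarith⟩
  refine ⟨max K₀ N, fun k hk l hl s hs ↦ ?_⟩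
  set M := max K₀ N with hM
  have hbase : ∀ i ≥ M, |g i s - g M s| ≤ 2 * (1 / 2 : ℝ) ^ N := by
    intro i hi
    obtain ⟨j, rfl⟩ := Nat.exists_eq_add_of_le hi
    refine (htail M (le_max_left _ _) j s hs).trans ?_
    exact mul_le_mul_of_nonneg_left
      (pow_le_pow_of_le_one (by norm_num) (by norm_num) (le_max_right _ _)) (by norm_num)
  rw [Real.dist_eq]
  calc |g k s - g l s| = |(g k s - g M s) - (g l s - g M s)| := by ring_nf
    _ ≤ |g k s - g M s| + |g l s - g M s| := abs_sub _ _
    _ ≤ 2 * (1 / 2 : ℝ) ^ N + 2 * (1 / 2 : ℝ) ^ N := add_le_add (hbase k hk) (hbase l hl)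
    _ < ε := by linarith

/-- A sequence of *continuous* paths which is uniformly Cauchy on every `[0, t]` converges,
uniformly on every `[0, t]`, to its pointwise `limUnder`, which is continuous. [folklore] -/
theorem tendstoUniformlyOn_limUnder {g : ℕ → ℝ≥0 → ℝ} (hc : ∀ k, Continuous (g k))
    (hg : ∀ t : ℝ≥0, UniformCauchySeqOn g atTop (Set.Iic t)) :
    (∀ t : ℝ≥0, TendstoUniformlyOn g (fun s ↦ limUnder atTop (g · s)) atTop (Set.Iic t)) ∧
      Continuous (fun s ↦ limUnder atTop (g · s)) := by
  have hpt : ∀ s : ℝ≥0, Tendsto (g · s) atTop (𝓝 (limUnder atTop (g · s))) := fun s ↦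
    ((hg s).cauchySeq (Set.mem_Iic.2 le_rfl)).tendsto_limUnder
  have hunif : ∀ t : ℝ≥0,
      TendstoUniformlyOn g (fun s ↦ limUnder atTop (g · s)) atTop (Set.Iic t) := fun t ↦
    (hg t).tendstoUniformlyOn_of_tendsto fun s _ ↦ hpt s
  refine ⟨hunif, ?_⟩
  -- continuity on each `[0, t]`, `t ∈ ℕ`, hence everywhere
  rw [continuous_iff_continuousAt]
  intro s
  obtain ⟨n, hn⟩ := exists_nat_gt (s : ℝ)
  have hcont : ContinuousOn (fun s ↦ limUnder atTop (g · s)) (Set.Iic (n : ℝ≥0)) :=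
    (hunif n).continuousOn (Frequently.of_forall fun k ↦ (hc k).continuousOn)
  exact hcont.continuousAt (Iic_mem_nhds (by exact_mod_cast hn))

/-! ### The u.c.p. limit -/

section UCP

variable {𝓕 : Filtration ℝ≥0 m} {Y : ℕ → ℝ≥0 → Ω → ℝ}

/-- **A fast subsequence**: if `Y` is Cauchy uniformly on compacts in probability, there is a
strictly increasing `φ` with `P(sup_{s ≤ k} |Y (φ (k+1)) s - Y (φ k) s| ≥ 2⁻ᵏ) ≤ 2⁻ᵏ`.
Revuz–Yor, *Continuous Martingales and Brownian Motion* (1999), Ch. IV, proof of Thm (1.8).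
[folklore] -/
theorem exists_fast_subseq
    (hcauchy : ∀ (t : ℝ≥0) (ε : ℝ), 0 < ε → ∀ δ : ℝ≥0∞, 0 < δ →
      ∃ N, ∀ n ≥ N, ∀ n' ≥ N, P {ω | ∃ s ≤ t, ε ≤ |Y n s ω - Y n' s ω|} ≤ δ) :
    ∃ φ : ℕ → ℕ, StrictMono φ ∧
      (∀ k : ℕ, P {ω | ∃ s ≤ ((k : ℕ) : ℝ≥0),
          (1 / 2 : ℝ) ^ k ≤ |Y (φ (k + 1)) s ω - Y (φ k) s ω|} ≤ (2⁻¹ : ℝ≥0∞) ^ k) ∧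
      ∀ (t : ℝ≥0) (ε : ℝ), 0 < ε → ∀ δ : ℝ≥0∞, 0 < δ →
        ∃ N, ∀ n ≥ N, ∀ k ≥ N, P {ω | ∃ s ≤ t, ε ≤ |Y n s ω - Y (φ k) s ω|} ≤ δ := by
  have hpos : ∀ k : ℕ, (0 : ℝ≥0∞) < (2⁻¹ : ℝ≥0∞) ^ k := fun k ↦
    ENNReal.pow_pos (by norm_num) k
  choose N hN using fun k : ℕ ↦ hcauchy ((k : ℕ) : ℝ≥0) ((1 / 2 : ℝ) ^ k) (by positivity)
    ((2⁻¹ : ℝ≥0∞) ^ k) (hpos k)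
  -- `φ k = k + max_{j ≤ k} N j` is strictly increasing and `φ k ≥ N k`
  let φ : ℕ → ℕ := fun k ↦ k + (range (k + 1)).sup N
  have hφN : ∀ k, N k ≤ φ k := fun k ↦
    (le_sup (f := N) (self_mem_range_succ k)).trans (Nat.le_add_left _ _)
  have hφmono : StrictMono φ := by
    refine strictMono_nat_of_lt_succ fun k ↦ ?_
    have : (range (k + 1)).sup N ≤ (range (k + 1 + 1)).sup N :=
      sup_mono (range_subset_range.2 (by omega))
    show k + (range (k + 1)).sup N < (k + 1) + (range (k + 1 + 1)).sup N
    omega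
  have hφge : ∀ k, k ≤ φ k := fun k ↦ Nat.le_add_right _ _
  refine ⟨φ, hφmono, fun k ↦ ?_, fun t ε hε δ hδ ↦ ?_⟩
  · exact hN k _ ((hφN k).trans (hφmono.monotone (Nat.le_succ k))) _ (hφN k)
  · obtain ⟨N₀, hN₀⟩ := hcauchy t ε hε δ hδ
    exact ⟨N₀, fun n hn k hk ↦ hN₀ n hn (φ k) (hk.trans (hφge k))⟩

/-- For `s < t` in `ℝ≥0` and `η > 0` there is a rational `r` whose image `(r : ℝ)⁺ ∈ ℝ≥0` is
within `η` of `s` and still `< t` (density of the rationals, used to test path properties at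
countably many times). [folklore] -/
theorem exists_rat_toNNReal_near {s t : ℝ≥0} (hst : s < t) {η : ℝ} (hη : 0 < η) :
    ∃ r : ℚ, dist ((r : ℝ).toNNReal) s < η ∧ ((r : ℝ).toNNReal) < t := by
  obtain ⟨r, hr1, hr2⟩ := exists_rat_btwn (show (s : ℝ) < min (s + η) t from
    lt_min (by linarith) (by exact_mod_cast hst))
  have hr0 : (0 : ℝ) ≤ r := s.2.trans hr1.le
  refine ⟨r, ?_, ?_⟩
  · rw [NNReal.dist_eq, Real.coe_toNNReal _ hr0, abs_of_pos (by linarith)]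
    linarith [min_le_left ((s : ℝ) + η) t]
  · have : (r : ℝ) < t := hr2.trans_le (min_le_right _ _)
    exact_mod_cast (show ((r : ℝ).toNNReal : ℝ) < t by rwa [Real.coe_toNNReal _ hr0])

/-- **Existence of u.c.p. limits without modification** (completeness of u.c.p. convergence for
continuous adapted processes, raw-filtration form): let `Y n` be processes with everywhere
continuous paths, strongly adapted to `𝓕`, Cauchy uniformly on compacts in probability under a
finite measure `P`. Then there is a process `J`, strongly adapted to `𝓕`, with a.s. continuous
paths, `J 0 = 0` wherever all `Y n 0 = 0`, such that `Y n → J` u.c.p. (`TendstoUCP`), and `J` is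
the locally uniform limit of a subsequence `Y (φ k)` almost surely.
Revuz–Yor, *Continuous Martingales and Brownian Motion* (1999), Ch. IV, proofs of Thm (1.8) and
Thm (2.12); Protter (2004), Ch. II, §4. [folklore] -/
theorem exists_tendstoUCP_of_cauchy [IsFiniteMeasure P]
    (hadapt : ∀ n, StronglyAdapted 𝓕 (Y n)) (hcont : ∀ n ω, Continuous (Y n · ω))
    (hcauchy : ∀ (t : ℝ≥0) (ε : ℝ), 0 < ε → ∀ δ : ℝ≥0∞, 0 < δ →
      ∃ N, ∀ n ≥ N, ∀ n' ≥ N, P {ω | ∃ s ≤ t, ε ≤ |Y n s ω - Y n' s ω|} ≤ δ) :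
    ∃ J : ℝ≥0 → Ω → ℝ, StronglyAdapted 𝓕 J ∧ (∀ᵐ ω ∂P, Continuous (J · ω)) ∧
      (∀ ω, (∀ n, Y n 0 ω = 0) → J 0 ω = 0) ∧ TendstoUCP Y J P ∧
      ∃ φ : ℕ → ℕ, StrictMono φ ∧
        ∀ᵐ ω ∂P, ∀ t : ℝ≥0,
          TendstoUniformlyOn (fun k s ↦ Y (φ k) s ω) (J · ω) atTop (Set.Iic t) := by
  obtain ⟨φ, hφ, hfast, hcauchy'⟩ := exists_fast_subseq hcauchy
  -- the limit, pointwise along the subsequence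
  let J : ℝ≥0 → Ω → ℝ := fun t ω ↦ limUnder atTop (fun k ↦ Y (φ k) t ω)
  -- the bad events of the fast subsequence
  let A : ℕ → Set Ω := fun k ↦
    {ω | ∃ s ≤ ((k : ℕ) : ℝ≥0), (1 / 2 : ℝ) ^ k ≤ |Y (φ (k + 1)) s ω - Y (φ k) s ω|}
  -- Borel–Cantelli
  have hsum : ∑' k, P (A k) ≠ ∞ := by
    refine ne_top_of_le_ne_top ?_ (ENNReal.tsum_le_tsum hfast)
    rw [ENNReal.tsum_geometric, ENNReal.one_sub_inv_two, inv_inv]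
    exact ENNReal.ofNat_ne_top
  have hBC : ∀ᵐ ω ∂P, ∃ K : ℕ, ∀ k ≥ K,
      ∀ s ≤ ((k : ℕ) : ℝ≥0), |Y (φ (k + 1)) s ω - Y (φ k) s ω| < (1 / 2 : ℝ) ^ k := by
    have h0 := (measure_eq_zero_iff_ae_notMem (μ := P)).1 (measure_limsup_atTop_eq_zero hsum)
    filter_upwards [h0] with ω hω
    rw [Filter.limsup_eq_iInf_iSup_of_nat] at hω
    simp only [Set.iInf_eq_iInter, Set.iSup_eq_iUnion, Set.mem_iInter, Set.mem_iUnion,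
      not_forall, not_exists, exists_prop] at hω
    obtain ⟨K, hK⟩ := hω
    refine ⟨K, fun k hk s hs ↦ ?_⟩
    by_contra hcon
    push Not at hcon
    exact hK k ⟨hk, s, hs, hcon⟩
  -- the good set: locally uniform convergence along `φ` and continuity of the limit
  have hgood : ∀ᵐ ω ∂P, (∀ t : ℝ≥0,
      TendstoUniformlyOn (fun k s ↦ Y (φ k) s ω) (J · ω) atTop (Set.Iic t)) ∧
        Continuous (J · ω) := by
    filter_upwards [hBC] with ω ⟨K, hK⟩
    have hUC : ∀ t : ℝ≥0, UniformCauchySeqOn (fun k s ↦ Y (φ k) s ω) atTop (Set.Iic t) :=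
      uniformCauchySeqOn_of_fast (g := fun k s ↦ Y (φ k) s ω) hK
    exact tendstoUniformlyOn_limUnder (g := fun k s ↦ Y (φ k) s ω) (fun k ↦ hcont (φ k) ω) hUC
  refine ⟨J, fun t ↦ ?_, hgood.mono fun ω hω ↦ hω.2, fun ω hω ↦ ?_, fun t ε hε ↦ ?_,
    φ, hφ, hgood.mono fun ω hω ↦ hω.1⟩
  · -- adapted: `J t` is the `limUnder` of `𝓕 t`-measurable maps
    letI : MeasurableSpace Ω := 𝓕 t
    exact StronglyMeasurable.limUnder (f := fun k ω ↦ Y (φ k) t ω) (l := atTop)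
      fun k ↦ hadapt (φ k) t
  · -- `J 0 = 0`
    show limUnder atTop (fun k ↦ Y (φ k) 0 ω) = 0
    simp only [hω]
    exact tendsto_const_nhds.limUnder_eq
  · -- u.c.p. convergence of the whole sequence
    rw [ENNReal.tendsto_nhds_zero]
    intro δ hδ
    have hδ2 : 0 < δ / 2 := by simpa using hδ.ne'
    have hε2 : 0 < ε / 2 := by positivity
    have hε4 : 0 < ε / 4 := by positivity
    obtain ⟨N₀, hN₀⟩ := hcauchy' t (ε / 2) hε2 (δ / 2) hδ2
    -- countable set of test times: images of rationals, and `t`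
    let D : Set ℝ≥0 := Set.range (fun r : ℚ ↦ (r : ℝ).toNNReal) ∪ {t}
    have hDc : D.Countable := (Set.countable_range _).union (Set.countable_singleton t)
    let F : ℕ → Set Ω := fun k ↦ ⋃ q ∈ D, {ω | q ≤ t ∧ ε / 4 < |Y (φ k) q ω - J q ω|}
    have hJm : ∀ q, Measurable (J q) := fun q ↦ by
      have : StronglyMeasurable[𝓕 q] (J q) := by
        letI : MeasurableSpace Ω := 𝓕 q
        exact StronglyMeasurable.limUnder (f := fun k ω ↦ Y (φ k) q ω) (l := atTop)
          fun k ↦ hadapt (φ k) q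
      exact (this.mono (𝓕.le q)).measurable
    have hFm : ∀ k, MeasurableSet (F k) := fun k ↦ by
      refine MeasurableSet.biUnion hDc fun q _ ↦ ?_
      by_cases hq : q ≤ t
      · simp only [hq, true_and]
        exact measurableSet_lt measurable_const
          ((((hadapt (φ k) q).mono (𝓕.le q)).measurable.sub (hJm q)).abs)
      · simp only [hq, false_and, Set.setOf_false, MeasurableSet.empty]
    -- a.e. eventually outside `F k`
    have hFev : ∀ᵐ ω ∂P, ∀ᶠ k in atTop, ω ∉ F k := by
      filter_upwards [hgood] with ω hω
      have h := Metric.tendstoUniformlyOn_iff.1 (hω.1 t) (ε / 4) hε4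
      filter_upwards [h] with k hk hmem
      simp only [F, Set.mem_iUnion, Set.mem_setOf_eq, exists_prop] at hmem
      obtain ⟨q, -, hqt, hq⟩ := hmem
      have := hk q (Set.mem_Iic.2 hqt)
      rw [Real.dist_eq, abs_sub_comm] at this
      exact absurd this (not_lt.2 hq.le)
    obtain ⟨K₁, hK₁⟩ := eventually_atTop.1
      ((ENNReal.tendsto_nhds_zero.1 (tendsto_measure_of_ae_eventually_notMem hFm hFev))
        (δ / 2) hδ2)
    -- the bad event at level `ε / 2` for `Y (φ k)` versus `J` is inside `F k` on the good set
    have hsubF : ∀ k ω, Continuous (J · ω) →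
        (∃ s ≤ t, ε / 2 ≤ |Y (φ k) s ω - J s ω|) → ω ∈ F k := by
      intro k ω hJc ⟨s, hst, hs⟩
      have hhc : Continuous fun u ↦ |Y (φ k) u ω - J u ω| :=
        continuous_abs.comp ((hcont (φ k) ω).sub hJc)
      simp only [F, Set.mem_iUnion, Set.mem_setOf_eq, exists_prop]
      rcases hst.eq_or_lt with rfl | hlt
      · exact ⟨s, Or.inr rfl, le_rfl, by linarith⟩
      · -- an open neighbourhood of `s` inside `Iio t` where the difference stays `> ε/4`
        have hopen : IsOpen ({u : ℝ≥0 | ε / 4 < |Y (φ k) u ω - J u ω|} ∩ Set.Iio t) :=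
          (isOpen_lt continuous_const hhc).inter isOpen_Iio
        have hsmem : s ∈ {u : ℝ≥0 | ε / 4 < |Y (φ k) u ω - J u ω|} ∩ Set.Iio t :=
          ⟨by show ε / 4 < _; linarith, hlt⟩
        obtain ⟨η, hη, hball⟩ := Metric.isOpen_iff.1 hopen s hsmem
        obtain ⟨r, hr, -⟩ := exists_rat_toNNReal_near hlt hη
        have hmem := hball (Metric.mem_ball.2 hr)
        exact ⟨(r : ℝ).toNNReal, Or.inl ⟨r, rfl⟩, hmem.2.le, hmem.1⟩
    have hgoodc : P {ω | ¬ ((∀ t : ℝ≥0,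
        TendstoUniformlyOn (fun k s ↦ Y (φ k) s ω) (J · ω) atTop (Set.Iic t)) ∧
          Continuous (J · ω))} = 0 := ae_iff.1 hgood
    refine eventually_atTop.2 ⟨N₀, fun n hn ↦ ?_⟩
    set k := max N₀ K₁ with hk
    have hsub : {ω | ∃ s ≤ t, ε ≤ |Y n s ω - J s ω|} ⊆
        {ω | ∃ s ≤ t, ε / 2 ≤ |Y n s ω - Y (φ k) s ω|} ∪
          (F k ∪ {ω | ¬ ((∀ t : ℝ≥0,
            TendstoUniformlyOn (fun k s ↦ Y (φ k) s ω) (J · ω) atTop (Set.Iic t)) ∧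
              Continuous (J · ω))}) := by
      rintro ω ⟨s, hst, hεs⟩
      by_cases h1 : ∃ s ≤ t, ε / 2 ≤ |Y n s ω - Y (φ k) s ω|
      · exact Or.inl h1
      push Not at h1
      right
      by_cases hg : (∀ t : ℝ≥0,
          TendstoUniformlyOn (fun k s ↦ Y (φ k) s ω) (J · ω) atTop (Set.Iic t)) ∧
            Continuous (J · ω)
      · refine Or.inl (hsubF k ω hg.2 ⟨s, hst, ?_⟩)
        have := h1 s hst
        have htri : |Y n s ω - J s ω| ≤ |Y n s ω - Y (φ k) s ω| + |Y (φ k) s ω - J s ω| :=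
          abs_sub_le _ _ _
        linarith
      · exact Or.inr hg
    calc P {ω | ∃ s ≤ t, ε ≤ |Y n s ω - J s ω|}
        ≤ P {ω | ∃ s ≤ t, ε / 2 ≤ |Y n s ω - Y (φ k) s ω|} + (P (F k) + P {ω | ¬ ((∀ t : ℝ≥0,
            TendstoUniformlyOn (fun k s ↦ Y (φ k) s ω) (J · ω) atTop (Set.Iic t)) ∧
              Continuous (J · ω))}) :=
          (measure_mono hsub).trans ((measure_union_le _ _).trans
            (add_le_add le_rfl (measure_union_le _ _)))
      _ ≤ δ / 2 + (δ / 2 + 0) := by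
          gcongr
          · exact hN₀ n hn k (le_max_left _ _)
          · exact hK₁ k (le_max_right _ _)
          · exact hgoodc.le
      _ = δ := by rw [add_zero, ENNReal.add_halves]

end UCP

end Literature.Probability.Process
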